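import Summits.CriticalPhenomena.PercolationContinuityZ3.Theorems.PercAnnulusCrossingIICCondFatZ3OfNonCrossing
import Summits.CriticalPhenomena.PercolationContinuityZ3.Theorems.PercAnnulusCrossingSetToSetQuasiMultFixedAspect
import HarnessLib

/-!
# Robust conditional annulus-uniqueness ALONE (+ UAD / X_B) ⇒ the IIC volume lower tail and `β⁻ + ρ⁺ = d` (lane RSW3, p1 gen 17)

builds on p205010 (kernel theorem, internal audit signed; external expert review pending) — NOT used in this file.

RSW3 lane (LANE 3 `prim-rsw3`), seat `prim-rsw3-p1` (gen 17).  Helper file (`--supports stmt-CriticalPhenomena-4575`); no definitions, no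
sorries.  Memo `run/shared/lean/prim/rsw3/P1-QM.md` §30.  Parts VI–VII took TWO quasi-multiplicativity hypotheses: (A2)□ at aspect `(s,L)`
AND `CU⁺_l(c_U)` (robust conditional annulus-uniqueness: `c_U·P(E) ≤ P(E ∩ U(a, la))` for increasing measurable `E`).  The first follows
from the second: `CU⁺_l(c)` contains the lane's `CU_l(c)` (the instance `E = {X ↔ ∂ⁱⁿΛ(la) in Z} ∩ {Y ↔ ∂ⁱⁿΛ(a) in Z}`), and the lane
proved `CU_l(c) ⇒ (A2′)_l(c)` (p1 gen 3, `setToSetQM'_fixedAspect_of_condAnnulusUniq`) and `(A2′)_l(c) ⇒ (A2)□` at aspect `(l, l²)`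
(p219928, `setToSetQM_fixedAspect_of_setToSetQM'`) at `p_c(ℤ^d)`.  Hence the GEN-17 theorems from `CU⁺_l` + `UAD` (resp. `CU⁺_l` + X_B
on `ℤ³`) alone.

* `condAnnulusUniq_of_robust` — `CU⁺_l(c) ⇒ CU_l(c)` (every `p`, `d`);
* **`setToSetQuasiMultAspectAt_of_robustCondAnnulusUniq`** — `CU⁺_l(c) ⇒ (A2)□` at aspect `(l, l·l)` at `p_c(ℤ^d)` (`d ≥ 2`);
* **`iicMeasure_real_volume_le_le_rpow_Zd_of_robustCondAnnulusUniq`**, **`iicMeasure_lower_mass_dimension_Zd_of_robustCondAnnulusUniq`** —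
  `CU⁺_l(c_U)` + `UAD` at `p_c(ℤ^d)` ⇒ the power-law lower tail and `β⁻ + ρ⁺ = d`;
* **`iicMeasure_real_volume_le_le_rpow_Z3_of_robustCondAnnulusUniq_of_critAnnulusNonCrossing`**,
  **`iicMeasure_lower_mass_dimension_Z3_of_robustCondAnnulusUniq_of_critAnnulusNonCrossing`** — `CU⁺_l(c_U)` + X_B at `p_c(ℤ³)`.
References: D. Basu, A. Sapozhnikov, ECP 22 (2017) §1, §3 (13)–(14), Thm. 1.1; H. Kesten, PTRF 73 (1986) Thm. (8).
-/

noncomputable section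

namespace Summit.CriticalPhenomena.PercolationContinuityZ3.Theorems.Crossing

open MeasureTheory Filter Topology Literature.Probability.Percolation Literature.Probability.LatticeModels
open Literature.Probability.Percolation.DCT16
open Summit.CriticalPhenomena.PercolationContinuityZ3.Theses
open Summit.CriticalPhenomena.PercolationContinuityZ3.Theorems.SurfaceTension
open scoped ENNReal NNReal

variable {d : ℕ}

/-- **`CU⁺_l(c) ⇒ CU_l(c)`** (every `p`, `d`): the lane's conditional annulus-uniqueness is the instance of the robust one at the increasing
event `{X ↔ ∂ⁱⁿΛ(la) in Z} ∩ {Y ↔ ∂ⁱⁿΛ(a) in Z}`. [cite: BasuSapozhnikov2017ECP, §1 (comments on (A2))] -/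
theorem condAnnulusUniq_of_robust (p : unitInterval) {l : ℕ} {c : ℝ}
    (hCU : ∀ a : ℕ, 1 ≤ a → ∀ E : Set (BondConfig (Site d)), IsUpperSet E → MeasurableSet E →
      c * (bondPercolation (zdGraph d) p).real E ≤ (bondPercolation (zdGraph d) p).real (E ∩
        {ω : BondConfig (Site d) | ∀ t ∈ innerBoundary (zdGraph d) (box d a), ∀ s ∈ innerBoundary (zdGraph d) (box d (l * a)),
          ∀ t' ∈ innerBoundary (zdGraph d) (box d a), ∀ s' ∈ innerBoundary (zdGraph d) (box d (l * a)),
          ω ∈ openConnIn (↑((box d (l * a) \ box d a) ∪ innerBoundary (zdGraph d) (box d a)) : Set (Site d)) t s →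
          ω ∈ openConnIn (↑((box d (l * a) \ box d a) ∪ innerBoundary (zdGraph d) (box d a)) : Set (Site d)) t' s' →
          ω ∈ openConnIn (↑((box d (l * a) \ box d a) ∪ innerBoundary (zdGraph d) (box d a)) : Set (Site d)) s s'})) :
    ∀ a : ℕ, 1 ≤ a → ∀ Z : Finset (Site d), box d (l * a) \ box d (a - 1) ⊆ Z →
      ∀ X : Finset (Site d), X ⊆ Z ∩ box d a → ∀ Y : Finset (Site d), Y ⊆ Z \ box d (l * a) →
        c * (bondPercolation (zdGraph d) p).real
            ({ω | ∃ x ∈ X, ∃ s ∈ innerBoundary (zdGraph d) (box d (l * a)), ω ∈ openConnIn (↑Z : Set (Site d)) x s} ∩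
             {ω | ∃ y ∈ Y, ∃ s ∈ innerBoundary (zdGraph d) (box d a), ω ∈ openConnIn (↑Z : Set (Site d)) y s}) ≤
          (bondPercolation (zdGraph d) p).real
            ({ω | ∃ x ∈ X, ∃ s ∈ innerBoundary (zdGraph d) (box d (l * a)), ω ∈ openConnIn (↑Z : Set (Site d)) x s} ∩
             {ω | ∃ y ∈ Y, ∃ s ∈ innerBoundary (zdGraph d) (box d a), ω ∈ openConnIn (↑Z : Set (Site d)) y s} ∩
             {ω | ∀ t ∈ innerBoundary (zdGraph d) (box d a), ∀ s ∈ innerBoundary (zdGraph d) (box d (l * a)),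
                ∀ t' ∈ innerBoundary (zdGraph d) (box d a), ∀ s' ∈ innerBoundary (zdGraph d) (box d (l * a)),
                ω ∈ openConnIn (↑((box d (l * a) \ box d a) ∪ innerBoundary (zdGraph d) (box d a)) : Set (Site d)) t s →
                ω ∈ openConnIn (↑((box d (l * a) \ box d a) ∪ innerBoundary (zdGraph d) (box d a)) : Set (Site d)) t' s' →
                ω ∈ openConnIn (↑((box d (l * a) \ box d a) ∪ innerBoundary (zdGraph d) (box d a)) : Set (Site d)) s s'}) :=
  fun a ha Z _ X _ Y _ =>
    hCU a ha _ ((isUpperSet_link Z X _).inter (isUpperSet_link Z Y _)) ((measurableSet_link Z X _).inter (measurableSet_link Z Y _))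

/-- **`CU⁺_l(c) ⇒ (A2)□ at aspect `(l, l·l)` at `p_c(ℤ^d)`** (`d ≥ 2`, `l ≥ 2`, `c ≥ 0`), with constant `c²·(2d)⁻¹·(1/(4l²))^{d−1}`:
`CU⁺ ⇒ CU ⇒ (A2′)_l ⇒ (A2)□(l, l²)` by the lane's p1-gen-3 chain. [cite: BasuSapozhnikov2017ECP, §3 eqs. (13)–(14)] -/
theorem setToSetQuasiMultAspectAt_of_robustCondAnnulusUniq (hd : 2 ≤ d) {l : ℕ} (hl : 2 ≤ l) {c : ℝ} (hc : 0 ≤ c)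
    (hCU : ∀ a : ℕ, 1 ≤ a → ∀ E : Set (BondConfig (Site d)), IsUpperSet E → MeasurableSet E →
      c * (bondPercolation (zdGraph d) (criticalProbI d)).real E ≤ (bondPercolation (zdGraph d) (criticalProbI d)).real (E ∩
        {ω : BondConfig (Site d) | ∀ t ∈ innerBoundary (zdGraph d) (box d a), ∀ s ∈ innerBoundary (zdGraph d) (box d (l * a)),
          ∀ t' ∈ innerBoundary (zdGraph d) (box d a), ∀ s' ∈ innerBoundary (zdGraph d) (box d (l * a)),
          ω ∈ openConnIn (↑((box d (l * a) \ box d a) ∪ innerBoundary (zdGraph d) (box d a)) : Set (Site d)) t s →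
          ω ∈ openConnIn (↑((box d (l * a) \ box d a) ∪ innerBoundary (zdGraph d) (box d a)) : Set (Site d)) t' s' →
          ω ∈ openConnIn (↑((box d (l * a) \ box d a) ∪ innerBoundary (zdGraph d) (box d a)) : Set (Site d)) s s'})) :
    SetToSetQuasiMultAspectAt d (criticalProbI d) l (l * l)
      (c ^ 2 * ((2 * (d : ℝ))⁻¹ * ((1 : ℝ) / (4 * ((l : ℝ) * l))) ^ (d - 1))) := by
  have h := setToSetQM_fixedAspect_of_setToSetQM' hd hl hc
    (setToSetQM'_fixedAspect_of_condAnnulusUniq (criticalProbI d) hl hc (condAnnulusUniq_of_robust (criticalProbI d) hCU))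
  intro m hm Z hZ X hX Y hY
  rw [Nat.mul_assoc] at hZ hY
  exact h m hm Z hZ X hX Y hY

open Classical in
/-- **THE IIC VOLUME LOWER TAIL IN `ℤ^d` FROM `CU⁺_l` + `UAD` ALONE** (`d ≥ 2`, `l ≥ 2`, `c_U > 0`, at `p_c(ℤ^d)`): every IIC-type probability
measure `ν` satisfies **`ν(#{x ∈ Λ(n) : 0 ↔ x} ≤ ε(2n+1)^dπ_{p_c}(n)) ≤ Cε^c`** (`n ≥ 1`, `ε > 0`).
[cite: Kesten1986, Thm. (8)] [cite: BasuSapozhnikov2017ECP, Thm. 1.1] -/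
theorem iicMeasure_real_volume_le_le_rpow_Zd_of_robustCondAnnulusUniq (hd : 2 ≤ d) {l : ℕ} (hl : 2 ≤ l) {cU : ℝ} (hcU : 0 < cU)
    (hCU : ∀ a : ℕ, 1 ≤ a → ∀ E : Set (BondConfig (Site d)), IsUpperSet E → MeasurableSet E →
      cU * (bondPercolation (zdGraph d) (criticalProbI d)).real E ≤ (bondPercolation (zdGraph d) (criticalProbI d)).real (E ∩
        {ω : BondConfig (Site d) | ∀ t ∈ innerBoundary (zdGraph d) (box d a), ∀ s ∈ innerBoundary (zdGraph d) (box d (l * a)),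
          ∀ t' ∈ innerBoundary (zdGraph d) (box d a), ∀ s' ∈ innerBoundary (zdGraph d) (box d (l * a)),
          ω ∈ openConnIn (↑((box d (l * a) \ box d a) ∪ innerBoundary (zdGraph d) (box d a)) : Set (Site d)) t s →
          ω ∈ openConnIn (↑((box d (l * a) \ box d a) ∪ innerBoundary (zdGraph d) (box d a)) : Set (Site d)) t' s' →
          ω ∈ openConnIn (↑((box d (l * a) \ box d a) ∪ innerBoundary (zdGraph d) (box d a)) : Set (Site d)) s s'}))
    (hUAD : ∀ ε : ℝ, 0 < ε → ∃ K₀ : ℕ, ∀ m : ℕ, 1 ≤ m → ∀ N : ℕ, K₀ * m ≤ N →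
      (bondPercolation (zdGraph d) (criticalProbI d)).real (boxCrossing d m N) ≤ ε) :
    ∃ C c : ℝ, 0 < C ∧ 0 < c ∧ ∀ (ν : Measure (BondConfig (Site d))) [IsProbabilityMeasure ν],
      (∀ (U : Finset (Sym2 (Site d))) (E : Set (BondConfig (Site d))), MeasurableSet E → DeterminedBy E ↑U →
        Tendsto (fun n : ℕ => (bondPercolation (zdGraph d) (criticalProbI d)).real (E ∩ siteToBoundary d n) /
          oneArmProb d (criticalProbI d) n) atTop (𝓝 (ν.real E))) →
      ∀ n : ℕ, 1 ≤ n → ∀ ε : ℝ, 0 < ε →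
        ν.real {ω | ((((box d n).filter fun z => ω ∈ (openConn (0 : Site d) z : Set (BondConfig (Site d)))).card : ℕ) : ℝ) ≤
          ε * (2 * (n : ℝ) + 1) ^ d * oneArmProb d (criticalProbI d) n} ≤ C * ε ^ c := by
  have hd0 : (0 : ℝ) < d := by exact_mod_cast (lt_of_lt_of_le (by norm_num) hd)
  have hl0 : (0 : ℝ) < l := by exact_mod_cast (lt_of_lt_of_le (by norm_num) hl)
  exact iicMeasure_real_volume_le_le_rpow_Zd hd hl (Nat.le_mul_of_pos_left l (by omega)) (by positivity)
    (setToSetQuasiMultAspectAt_of_robustCondAnnulusUniq hd hl hcU.le hCU) hl hcU hCU hUAD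

open Classical in
/-- **THE LOWER MASS DIMENSION `β⁻ + ρ⁺ = d` FROM `CU⁺_l` + `UAD` ALONE** (`d ≥ 2`, `l ≥ 2`, `c_U > 0`, at `p_c(ℤ^d)`; every IIC-type `ν`):
`β⁻ + ρ⁺ = d`, `β⁺ + ρ⁻ ≤ d`, and `β⁻ + 1/ρ = d` if the one-arm exponent exists. [cite: Kesten1986, Thm. (8)] [cite: BasuSapozhnikov2017ECP, Thm. 1.1] -/
theorem iicMeasure_lower_mass_dimension_Zd_of_robustCondAnnulusUniq (hd : 2 ≤ d) {l : ℕ} (hl : 2 ≤ l) {cU : ℝ} (hcU : 0 < cU)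
    (hCU : ∀ a : ℕ, 1 ≤ a → ∀ E : Set (BondConfig (Site d)), IsUpperSet E → MeasurableSet E →
      cU * (bondPercolation (zdGraph d) (criticalProbI d)).real E ≤ (bondPercolation (zdGraph d) (criticalProbI d)).real (E ∩
        {ω : BondConfig (Site d) | ∀ t ∈ innerBoundary (zdGraph d) (box d a), ∀ s ∈ innerBoundary (zdGraph d) (box d (l * a)),
          ∀ t' ∈ innerBoundary (zdGraph d) (box d a), ∀ s' ∈ innerBoundary (zdGraph d) (box d (l * a)),
          ω ∈ openConnIn (↑((box d (l * a) \ box d a) ∪ innerBoundary (zdGraph d) (box d a)) : Set (Site d)) t s →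
          ω ∈ openConnIn (↑((box d (l * a) \ box d a) ∪ innerBoundary (zdGraph d) (box d a)) : Set (Site d)) t' s' →
          ω ∈ openConnIn (↑((box d (l * a) \ box d a) ∪ innerBoundary (zdGraph d) (box d a)) : Set (Site d)) s s'}))
    (hUAD : ∀ ε : ℝ, 0 < ε → ∃ K₀ : ℕ, ∀ m : ℕ, 1 ≤ m → ∀ N : ℕ, K₀ * m ≤ N →
      (bondPercolation (zdGraph d) (criticalProbI d)).real (boxCrossing d m N) ≤ ε)
    {ν : Measure (BondConfig (Site d))} [IsProbabilityMeasure ν]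
    (hν : ∀ (F : Finset (Sym2 (Site d))) (E : Set (BondConfig (Site d))), MeasurableSet E → DeterminedBy E ↑F →
      Tendsto (fun n : ℕ => (bondPercolation (zdGraph d) (criticalProbI d)).real (E ∩ siteToBoundary d n) /
        oneArmProb d (criticalProbI d) n) atTop (𝓝 (ν.real E))) :
    ∃ βl βu : ℝ≥0∞, (βl ≤ βu ∧ βu ≤ d ∧
      βl + limsup (fun n : ℕ => ENNReal.ofReal (-Real.log (oneArmProb d (criticalProbI d) n) / Real.log ((n : ℝ) + 2))) atTop = d ∧
      βu + liminf (fun n : ℕ => ENNReal.ofReal (-Real.log (oneArmProb d (criticalProbI d) n) / Real.log ((n : ℝ) + 2))) atTop ≤ d ∧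
      (∀ ρinv : ℝ≥0∞, Tendsto (fun n : ℕ => ENNReal.ofReal (-Real.log (oneArmProb d (criticalProbI d) n) / Real.log ((n : ℝ) + 2)))
        atTop (𝓝 ρinv) → βl + ρinv = d)) ∧
      ∀ᵐ ω ∂ν,
      liminf (fun n => ENNReal.ofReal
        (Real.log ((((box d n).filter fun z => ω ∈ (openConn (0 : Site d) z : Set (BondConfig (Site d)))).card : ℕ) : ℝ) /
          Real.log ((n : ℝ) + 2))) atTop = βl ∧
      limsup (fun n => ENNReal.ofReal
        (Real.log ((((box d n).filter fun z => ω ∈ (openConn (0 : Site d) z : Set (BondConfig (Site d)))).card : ℕ) : ℝ) /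
          Real.log ((n : ℝ) + 2))) atTop = βu := by
  have hd0 : (0 : ℝ) < d := by exact_mod_cast (lt_of_lt_of_le (by norm_num) hd)
  have hl0 : (0 : ℝ) < l := by exact_mod_cast (lt_of_lt_of_le (by norm_num) hl)
  exact iicMeasure_lower_mass_dimension_Zd hd hl (Nat.le_mul_of_pos_left l (by omega)) (by positivity)
    (setToSetQuasiMultAspectAt_of_robustCondAnnulusUniq hd hl hcU.le hCU) hl hcU hCU hUAD hν

open Classical in
/-- **`ℤ³`: THE IIC VOLUME LOWER TAIL FROM `CU⁺_l` + X_B** (`l ≥ 2`, `c_U > 0`, at `p_c(ℤ³)`; X_B = `CritAnnulusNonCrossing`, stmt-0846):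
every IIC-type probability measure `ν` satisfies `ν(#{x ∈ Λ(n) : 0 ↔ x} ≤ ε(2n+1)³π_{p_c}(n)) ≤ Cε^c` (`n ≥ 1`, `ε > 0`).
[cite: Kesten1986, Thm. (8)] [cite: BasuSapozhnikov2017ECP, Thm. 1.1] -/
theorem iicMeasure_real_volume_le_le_rpow_Z3_of_robustCondAnnulusUniq_of_critAnnulusNonCrossing {l : ℕ} (hl : 2 ≤ l)
    {cU : ℝ} (hcU : 0 < cU)
    (hCU : ∀ a : ℕ, 1 ≤ a → ∀ E : Set (BondConfig (Site 3)), IsUpperSet E → MeasurableSet E →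
      cU * (bondPercolation (zdGraph 3) (criticalProbI 3)).real E ≤ (bondPercolation (zdGraph 3) (criticalProbI 3)).real (E ∩
        {ω : BondConfig (Site 3) | ∀ t ∈ innerBoundary (zdGraph 3) (box 3 a), ∀ s ∈ innerBoundary (zdGraph 3) (box 3 (l * a)),
          ∀ t' ∈ innerBoundary (zdGraph 3) (box 3 a), ∀ s' ∈ innerBoundary (zdGraph 3) (box 3 (l * a)),
          ω ∈ openConnIn (↑((box 3 (l * a) \ box 3 a) ∪ innerBoundary (zdGraph 3) (box 3 a)) : Set (Site 3)) t s →
          ω ∈ openConnIn (↑((box 3 (l * a) \ box 3 a) ∪ innerBoundary (zdGraph 3) (box 3 a)) : Set (Site 3)) t' s' →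
          ω ∈ openConnIn (↑((box 3 (l * a) \ box 3 a) ∪ innerBoundary (zdGraph 3) (box 3 a)) : Set (Site 3)) s s'}))
    (hXB : PercAnnulusCrossing.CritAnnulusNonCrossing) :
    ∃ C c : ℝ, 0 < C ∧ 0 < c ∧ ∀ (ν : Measure (BondConfig (Site 3))) [IsProbabilityMeasure ν],
      (∀ (U : Finset (Sym2 (Site 3))) (E : Set (BondConfig (Site 3))), MeasurableSet E → DeterminedBy E ↑U →
        Tendsto (fun n : ℕ => (bondPercolation (zdGraph 3) (criticalProbI 3)).real (E ∩ siteToBoundary 3 n) /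
          oneArmProb 3 (criticalProbI 3) n) atTop (𝓝 (ν.real E))) →
      ∀ n : ℕ, 1 ≤ n → ∀ ε : ℝ, 0 < ε →
        ν.real {ω | ((((box 3 n).filter fun z => ω ∈ (openConn (0 : Site 3) z : Set (BondConfig (Site 3)))).card : ℕ) : ℝ) ≤
          ε * (2 * (n : ℝ) + 1) ^ 3 * oneArmProb 3 (criticalProbI 3) n} ≤ C * ε ^ c :=
  iicMeasure_real_volume_le_le_rpow_Zd_of_robustCondAnnulusUniq (d := 3) (by norm_num) hl hcU hCU (uad_of_critAnnulusNonCrossing hXB)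

open Classical in
/-- **`ℤ³`: THE LOWER MASS DIMENSION OF KESTEN'S IIC IS `3 − ρ⁺` FROM `CU⁺_l` + X_B** (`l ≥ 2`, `c_U > 0`, at `p_c(ℤ³)`; every IIC-type `ν`):
`β⁻ + ρ⁺ = 3`, `β⁺ + ρ⁻ ≤ 3`, and `β⁻ + 1/ρ = 3` if the one-arm exponent exists — Kesten's IIC on `ℤ³` exists under `CU_l` alone (lane,
p1 gen 3–5); two further hypotheses on critical annuli of ONE large aspect pin its lower mass dimension.
[cite: Kesten1986, Thm. (8)] [cite: BasuSapozhnikov2017ECP, Thm. 1.1] -/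
theorem iicMeasure_lower_mass_dimension_Z3_of_robustCondAnnulusUniq_of_critAnnulusNonCrossing {l : ℕ} (hl : 2 ≤ l)
    {cU : ℝ} (hcU : 0 < cU)
    (hCU : ∀ a : ℕ, 1 ≤ a → ∀ E : Set (BondConfig (Site 3)), IsUpperSet E → MeasurableSet E →
      cU * (bondPercolation (zdGraph 3) (criticalProbI 3)).real E ≤ (bondPercolation (zdGraph 3) (criticalProbI 3)).real (E ∩
        {ω : BondConfig (Site 3) | ∀ t ∈ innerBoundary (zdGraph 3) (box 3 a), ∀ s ∈ innerBoundary (zdGraph 3) (box 3 (l * a)),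
          ∀ t' ∈ innerBoundary (zdGraph 3) (box 3 a), ∀ s' ∈ innerBoundary (zdGraph 3) (box 3 (l * a)),
          ω ∈ openConnIn (↑((box 3 (l * a) \ box 3 a) ∪ innerBoundary (zdGraph 3) (box 3 a)) : Set (Site 3)) t s →
          ω ∈ openConnIn (↑((box 3 (l * a) \ box 3 a) ∪ innerBoundary (zdGraph 3) (box 3 a)) : Set (Site 3)) t' s' →
          ω ∈ openConnIn (↑((box 3 (l * a) \ box 3 a) ∪ innerBoundary (zdGraph 3) (box 3 a)) : Set (Site 3)) s s'}))
    (hXB : PercAnnulusCrossing.CritAnnulusNonCrossing)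
    {ν : Measure (BondConfig (Site 3))} [IsProbabilityMeasure ν]
    (hν : ∀ (F : Finset (Sym2 (Site 3))) (E : Set (BondConfig (Site 3))), MeasurableSet E → DeterminedBy E ↑F →
      Tendsto (fun n : ℕ => (bondPercolation (zdGraph 3) (criticalProbI 3)).real (E ∩ siteToBoundary 3 n) /
        oneArmProb 3 (criticalProbI 3) n) atTop (𝓝 (ν.real E))) :
    ∃ βl βu : ℝ≥0∞, (βl ≤ βu ∧ βu ≤ 3 ∧
      βl + limsup (fun n : ℕ => ENNReal.ofReal (-Real.log (oneArmProb 3 (criticalProbI 3) n) / Real.log ((n : ℝ) + 2))) atTop = 3 ∧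
      βu + liminf (fun n : ℕ => ENNReal.ofReal (-Real.log (oneArmProb 3 (criticalProbI 3) n) / Real.log ((n : ℝ) + 2))) atTop ≤ 3 ∧
      (∀ ρinv : ℝ≥0∞, Tendsto (fun n : ℕ => ENNReal.ofReal (-Real.log (oneArmProb 3 (criticalProbI 3) n) / Real.log ((n : ℝ) + 2)))
        atTop (𝓝 ρinv) → βl + ρinv = 3)) ∧
      ∀ᵐ ω ∂ν,
      liminf (fun n => ENNReal.ofReal
        (Real.log ((((box 3 n).filter fun z => ω ∈ (openConn (0 : Site 3) z : Set (BondConfig (Site 3)))).card : ℕ) : ℝ) /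
          Real.log ((n : ℝ) + 2))) atTop = βl ∧
      limsup (fun n => ENNReal.ofReal
        (Real.log ((((box 3 n).filter fun z => ω ∈ (openConn (0 : Site 3) z : Set (BondConfig (Site 3)))).card : ℕ) : ℝ) /
          Real.log ((n : ℝ) + 2))) atTop = βu := by
  have h := iicMeasure_lower_mass_dimension_Zd_of_robustCondAnnulusUniq (d := 3) (by norm_num) hl hcU hCU
    (uad_of_critAnnulusNonCrossing hXB) hν
  push_cast at h ⊢
  exact h

end Summit.CriticalPhenomena.PercolationContinuityZ3.Theorems.Crossing

end
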